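import Literature.MathematicalPhysics.QuantumFieldTheory.Balaban1983to89.HiggsFluctMeasureWickProdFluctuation
import Literature.MathematicalPhysics.QuantumFieldTheory.Balaban1983to89.HiggsFluctMeasureWickProductsModels
import HarnessLib

/-!
# `Balaban1983to89.HiggsFluctMeasureWickProdFluctuationModels` — the MODEL INSTANCES of the typer's
# `HiggsFluctMeasureWickProdFluctuation` (Janson Thm 4.9 + (4.3): fluctuation integration ∕ martingale property of multi-point Wick
# products; Glimm–Jaffe (9.1.21)) on the three Gaussian laws the cell integrates against

statement-level skeleton of published theorems with citation tags; proofs where landed; nothing here is a claim about the Yang–Mills mass gap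

CITATION HEADER (lean-in-tree rule).  lit-balaban typed skeleton (HOME `run/shared/lean/pub/lit-balaban/`), unit `lit-balaban-typer`
gen 40 (free target G.5-34 (d), zero head weight; TAKING #2 on HOME/STATUS.md).  Sources: T. Bałaban, *(Higgs)₂,₃ quantum fields in a
finite volume* I [Balaban1982Higgs1] (3.56)–(3.57) p.622 (the Gaussian law `dμ_{C^{(k)}}(A′)dμ_{C^{(k)}(B^{(k+1)})}(φ′)` of the
fluctuation step and its legs), p.617 *"independent Gaussian random variables with the covariances C^{(j),L^jε}"*; III
[Balaban1983Higgs3] (1.4) p.412 (the fluctuation measures `dμ_{C^{(j),L^jη}}(A′_j)` of the auxiliary function `E_k`), p.414 *"All the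
A′-legs are contracted, i.e. they are divided into pairs and each pair is replaced by the corresponding propagator"*, (2.25)–(2.26)
p.431 (the lattice Gaussian field `dμ_C`); S. Janson, *Gaussian Hilbert Spaces* (1997) [Janson1997] Thm 4.9 p.44 with Thm 4.5 (4.3)
p.43 (`E(:ξ₁⋯ξₙ: | 𝓕(K)) = :Pξ₁⋯Pξₙ:`), Rem. 9.11 p.125; J. Glimm, A. Jaffe, *Quantum Physics* (2nd ed. 1987) [GlimmJaffeQP1987]
(9.1.17), (9.1.20)–(9.1.21) p.153 *"∫:A(φ):_C dφ_C = A(φ = 0)"*, (9.1.27′) p.155.  USED BY NAME, nothing restated: the typer's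
`HiggsFluctMeasureWickProdFluctuation` (engines `integral_wickProd_add_fluct_of_wick` §9, `functional_wickProd_add_fluct` §10, and
`integral_wickProd_add_fluct` §4), g30's `HiggsFluctMeasureWickSum.integral_prodLegs_eq_wickSum` + `HiggsFluctMeasureWick.integrable_prodLegs`
(Wick's theorem for `dμ_{C^{(j)}}`), r14's `B1Eq323DisplayedCumulantBound.integral_law356_eq_gexp` with p13/p33's `gexp` calculus
(`gexp_prod_legs_eq_wickSum`, `gexp_sum_powerset_mul_prod`) and g35's `inv_blockPrec_legVecS_dotProduct` (the covariance of (3.56) =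
`(L^kε)^{d−2}·propKer`), p39's `B3GaussianContractions.isGaussianProcess_inner_fld` ∕ `integral_inner_fld` ∕
`B3WTFreeWick.integral_inner_fld_inner_fldK` (the field insertions of `dμ_C`).

WHAT IS PROVED (0 `sorry`, 0 named facts, theorems only; all orders, any finite leg set, any Wick-ordering kernel `S` of the background).
§1 `dμ_{C^{(j),L^jη}}` OF [III] (1.4) (`HiggsFluctMeasure.fluctMeasure P msq a j`; legs `⟨A′,f_i⟩`, covariance `C i i′ = ⟨f_{i′}, C^{(j)}f_i⟩`;
  `msq > 0`, `a > 0`, `L > 1`, `j ≤ K`): **`integral_wickProd_add_fluct_fluctMeasure`** —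
  `∫ :Π_{i∈U}(ψ_i(ω′) + ⟨A′,f_i⟩):_{S+C} dμ_{C^{(j)}}(A′) = :Π_{i∈U} ψ_i:_S (ω′)`; `…_self` (`S = 0`: `= Π ψ_i`);
  `integral_prodLegs_add_fluctMeasure` (shifted moments `∫ Π_U(ψ_i + ⟨A′,f_i⟩) dμ_{C^{(j)}} = :Π_U ψ:_{−C}`).
§2 THE LAW OF (I.3.56) (`B1Eq357FluctuationPolynomial.law356`; legs (3.57) `legVal k A′ φ′ l y`, covariance `(L^kε)^{d−2}·propKer`, mixed
  pairs `0`; `μ₀², m² > 0`, `a > 0`, `L > 1`, `k ≤ K`): **`integral_wickProd_add_fluct_law356`**, `…_self`, `integral_prod_legVal_add_law356`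
  — via r14's presentation `∫ G d(law356) = gexp blockPrec 0 (G ∘ Ψ)` and the FUNCTIONAL engine (§10 of the engine file).
§3 p39's LATTICE GAUSSIAN FIELD `dμ_C` (`B3WTFreeWick.kernelMeasure d N Cv`, any positive-semidefinite colour-diagonal kernel; insertions
  `⟪φ(y_i),u_i⟫`, covariance `C(y_i − y_j)⟪u_i,u_j⟫`): **`integral_wickProd_add_fluct_kernelMeasure`**, `…_self`,
  `integral_prod_inner_fld_add_kernelMeasure` — via p39's `IsGaussianProcess` presentation (§4 of the engine file directly).
§4 `dμ_{C^{(j)}}` AS THE FLUCTUATION FACTOR OF A PRODUCT SPACE `P′ ⊗ dμ_{C^{(j)}}` (Janson Rem. 9.11 / Thm 4.9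
  verbatim): `measurable_leg`, **`integral_prod_mul_wickProd_add_fluct_fluctMeasure`** (test functions of the background),
  **`condExp_wickProd_add_fluct_fluctMeasure`** (Mathlib `condExp` given the background coordinate `= :Π_U ψ:_S` a.e.).
§5 THE SAME FOR p39's `dμ_C`: **`integral_prod_mul_wickProd_add_fluct_kernelMeasure`**, **`condExp_wickProd_add_fluct_kernelMeasure`**
  (via p39's `isGaussianProcess_inner_fld` + `measurable_inner_fld` into §5/§6 of the engine file).
HONEST SCOPE.  Instances on the laws of record, obtained BY NAME from their Wick theorems ∕ Gaussian-process presentations; finite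
Gaussian combinatorics only; rows keep their heads; NOT summit progress; NOT Clay.
-/

noncomputable section

open Finset
open scoped BigOperators Nat InnerProductSpace

namespace Literature.MathematicalPhysics.QuantumFieldTheory.Balaban1983to89.HiggsFluctMeasureWickProdFluctuationModels

open _root_.MeasureTheory _root_.ProbabilityTheory Matrix
open Literature.Probability.Distributions
open HiggsFluctMeasureWickSum (wickSum wickSum_empty)
open HiggsFluctMeasureWickPairings (wickSum_congr)
open HiggsFluctMeasureWickProducts (wickProd wickProd_def)
open HiggsFluctMeasureWickProductsModels (wickProd_congr_apply)
open HiggsFluctMeasureWickProdFluctuation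

/-! ## §1 The fluctuation measures `dμ_{C^{(j),L^jη}}(A′_j)` of [III] (1.4) -/

section FluctMeasure

open HiggsLattice (siteInner)
open B3MultiscaleFields (toSite)
open HiggsFluctMeasure (fluctMeasure fluctCov)
open HiggsFluctMeasureWick (integrable_prodLegs)
open HiggsFluctMeasureWickSum (integral_prodLegs_eq_wickSum)

variable {P : HiggsLattice.Params} {msq a : ℝ} {j : ℕ} {ι : Type*} [LinearOrder ι] {Ω' : Type*}

/-- **FLUCTUATION INTEGRATION AGAINST `dμ_{C^{(j),L^jη}}`** ([III] (1.4) p.412; I p.617 *"independent Gaussian random variables with the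
covariances C^{(j),L^jε}"*): for every finite family of legs `f_i`, every Wick-ordering kernel `S` of the background and every background
family `ψ_i(ω′)`, `∫ :Π_{i∈U}(ψ_i(ω′) + ⟨A′,f_i⟩):_{S+C} dμ_{C^{(j)}}(A′) = :Π_{i∈U} ψ_i:_S (ω′)` with `C i i′ = ⟨f_{i′}, C^{(j)}f_i⟩` the
propagator of the pair — Janson Thm 4.9 + (4.3) ∕ Glimm–Jaffe (9.1.21) for this law, from Wick's theorem for `dμ_{C^{(j)}}`
(g30's `integral_prodLegs_eq_wickSum`, print p.414 *"each pair is replaced by the corresponding propagator"*) through the engine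
`integral_wickProd_add_fluct_of_wick`; `msq > 0`, `a > 0`, `L > 1`, `j ≤ K`. [cite: Balaban1983Higgs3, (1.4) p.412, p.414]
[cite: Janson1997, Thm 4.9 p.44, Thm 4.5 (4.3) p.43] [cite: GlimmJaffeQP1987, (9.1.20)–(9.1.21) §9.1 p.153] -/
theorem integral_wickProd_add_fluct_fluctMeasure (hmsq : 0 < msq) (ha : 0 < a) (hL : 1 < (P.L : ℝ)) (hj : j ≤ P.K)
    (f : ι → HiggsLattice.VecField P j) (S : ι → ι → ℝ) (ψ : ι → Ω' → ℝ) (ω' : Ω') (U : Finset ι) :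
    ∫ A, wickProd (fun i i' => S i i' + siteInner (toSite (f i')) (fluctCov P msq a j (toSite (f i))))
        (fun i A => ψ i ω' + siteInner (toSite A) (toSite (f i))) U A ∂(fluctMeasure P msq a j) = wickProd S ψ U ω' := by
  have h := integral_wickProd_add_fluct_of_wick (μ := fluctMeasure P msq a j) (U := U) (m := 1)
    (X := fun i A => siteInner (toSite A) (toSite (f i)))
    (C := fun i i' => siteInner (toSite (f i')) (fluctCov P msq a j (toSite (f i))))
    (fun R _ => by rw [one_mul]; exact integral_prodLegs_eq_wickSum hmsq ha hL hj f R)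
    (fun R _ => integrable_prodLegs hmsq ha hL hj R f) S ψ ω'
  rw [one_mul] at h
  exact h

/-- `S = 0`: Wick order in `C^{(j)}` itself — `∫ :Π_{i∈U}(ψ_i + ⟨A′,f_i⟩):_{C^{(j)}} dμ_{C^{(j)}}(A′) = Π_{i∈U} ψ_i` (Glimm–Jaffe (9.1.21)
*"∫:A(φ):_C dφ_C = A(φ = 0)"* after the translation by the background, for the law `dμ_{C^{(j)}}` of [III] (1.4)).
[cite: Balaban1983Higgs3, (1.4) p.412, p.414] [cite: GlimmJaffeQP1987, (9.1.21) §9.1 p.153, (9.1.27′) p.155] -/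
theorem integral_wickProd_add_fluct_fluctMeasure_self (hmsq : 0 < msq) (ha : 0 < a) (hL : 1 < (P.L : ℝ)) (hj : j ≤ P.K)
    (f : ι → HiggsLattice.VecField P j) (ψ : ι → Ω' → ℝ) (ω' : Ω') (U : Finset ι) :
    ∫ A, wickProd (fun i i' => siteInner (toSite (f i')) (fluctCov P msq a j (toSite (f i))))
        (fun i A => ψ i ω' + siteInner (toSite A) (toSite (f i))) U A ∂(fluctMeasure P msq a j) = ∏ i ∈ U, ψ i ω' := by
  have h := integral_wickProd_add_fluct_self_of_wick (μ := fluctMeasure P msq a j) (U := U) (m := 1)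
    (X := fun i A => siteInner (toSite A) (toSite (f i)))
    (C := fun i i' => siteInner (toSite (f i')) (fluctCov P msq a j (toSite (f i))))
    (fun R _ => by rw [one_mul]; exact integral_prodLegs_eq_wickSum hmsq ha hL hj f R)
    (fun R _ => integrable_prodLegs hmsq ha hL hj R f) ψ ω'
  rw [one_mul] at h
  exact h

/-- **Moments of the legs shifted by a background under `dμ_{C^{(j)}}`**: `∫ Π_{i∈U}(ψ_i + ⟨A′,f_i⟩) dμ_{C^{(j)}}(A′) = :Π_{i∈U} ψ_i:_{−C}
(ω′)` — print's contraction rule p.414 for the legs of a translated field (the perturbative expansion around a background).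
[cite: Balaban1983Higgs3, (1.4) p.412, p.414] [cite: GlimmJaffeQP1987, (9.1.17) §9.1 p.153, (9.1.27′) p.155] -/
theorem integral_prodLegs_add_fluctMeasure (hmsq : 0 < msq) (ha : 0 < a) (hL : 1 < (P.L : ℝ)) (hj : j ≤ P.K)
    (f : ι → HiggsLattice.VecField P j) (ψ : ι → Ω' → ℝ) (ω' : Ω') (U : Finset ι) :
    ∫ A, ∏ i ∈ U, (ψ i ω' + siteInner (toSite A) (toSite (f i))) ∂(fluctMeasure P msq a j) =
      wickProd (fun i i' => -siteInner (toSite (f i')) (fluctCov P msq a j (toSite (f i)))) ψ U ω' := by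
  have h := integral_prod_add_eq_wickProd_neg_of_wick (μ := fluctMeasure P msq a j) (U := U) (m := 1)
    (X := fun i A => siteInner (toSite A) (toSite (f i)))
    (C := fun i i' => siteInner (toSite (f i')) (fluctCov P msq a j (toSite (f i))))
    (fun R _ => by rw [one_mul]; exact integral_prodLegs_eq_wickSum hmsq ha hL hj f R)
    (fun R _ => integrable_prodLegs hmsq ha hL hj R f) ψ ω'
  rw [one_mul] at h
  exact h

end FluctMeasure

/-! ## §2 The law of (I.3.56) `dμ_{C^{(k)}}(A′)dμ_{C^{(k)}(B^{(k+1)})}(φ′)` and its legs (3.57) -/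

section Law356

open HiggsLattice (ChargeData)
open HiggsCondGauss228 (fieldOfCrd)
open Literature.MathematicalPhysics.QuantumFieldTheory.BalabanImbrieJaffe1984to88
open BIJ88TruncationConnected306 (gexp)
open B1Prop32InteractionBound (Leg legVal)
open B1Eq357FluctuationPolynomial (law356)
open B1Eq323DisplayedCumulantBound (blockPrec blockPrec_posDef Ψ legVecS dotProduct_legVecS integral_law356_eq_gexp propKer)
open HiggsFluctMeasureWickPairings (gexp_prod_legs_eq_wickSum)
open HiggsFluctMeasureWickPairingsModels (inv_blockPrec_legVecS_dotProduct)
open HiggsFluctMeasureWickProductsModels (gexp_sum_powerset_mul_prod)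

variable {P : HiggsLattice.Params} {N : ℕ} (C : ChargeData N) (Ω : Finset (HiggsLattice.Site P 0)) (B : HiggsLattice.VecField P 0)
  {μ0sq msq a : ℝ} {k : ℕ} {Ω' : Type*}

/-- The Wick hypothesis of the functional engine for p13's Gaussian presentation of the law of (3.56): every leg monomial has the Wick
value with covariance `(L^kε)^{d−2}·propKer` and mass `1` (g35's `gexp_prod_legs_eq_wickSum` + `inv_blockPrec_legVecS_dotProduct`).
[cite: Balaban1982Higgs1, (3.56) p.622] [cite: Janson1997, Thm 1.28 (1.2)] -/
theorem gexp_prod_legVecS_eq_wickSum (hμ : 0 < μ0sq) (hmsq : 0 < msq) (ha : 0 < a) (hL : 1 < (P.L : ℝ)) (hk : k ≤ P.K)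
    {ι : Type} [LinearOrder ι] (lab : ι → Leg N P.d × HiggsLattice.Site P k) (R : Finset ι) :
    gexp (blockPrec C Ω B μ0sq msq a k) 0 (fun Φ => ∏ i ∈ R, (fun i Φ => Φ ⬝ᵥ legVecS k (lab i).1 (lab i).2) i Φ) =
      1 * wickSum (fun i i' => P.mesh k ^ ((P.d : ℝ) - 2) * propKer C Ω B μ0sq msq a k (lab i).1 (lab i).2 (lab i').1 (lab i').2) R := by
  classical
  have hbp := blockPrec_posDef C Ω B hμ hmsq ha hL hk
  have h := gexp_prod_legs_eq_wickSum hbp (fun i => legVecS k (lab i).1 (lab i).2) R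
  have h2 : wickSum (fun i i' => ((blockPrec C Ω B μ0sq msq a k)⁻¹ *ᵥ legVecS k (lab i).1 (lab i).2) ⬝ᵥ
      legVecS k (lab i').1 (lab i').2) R = wickSum (fun i i' => P.mesh k ^ ((P.d : ℝ) - 2)
          * propKer C Ω B μ0sq msq a k (lab i).1 (lab i).2 (lab i').1 (lab i').2) R := by
    refine wickSum_congr fun i _ i' _ _ => ?_
    convert inv_blockPrec_legVecS_dotProduct C Ω B hμ hmsq ha hL hk (lab i).1 (lab i').1 (lab i).2 (lab i').2 using 3
  rw [one_mul, ← h2]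
  convert h using 2

/-- **FLUCTUATION INTEGRATION AGAINST THE LAW OF (I.3.56)**: for legs `lab i = (l_i, y_i)` of the fluctuation polynomial (3.57)
(`legVal`: `A′(⟨y,μ⟩)` or `φ′_j(y)`, rescaled), every Wick-ordering kernel `S` of the background and every background family `ψ_i(ω′)`,
`∫ :Π_{i∈U}(ψ_i(ω′) + legVal_i):_{S+C} dμ_{C^{(k)}}(A′)dμ_{C^{(k)}(B^{(k+1)})}(φ′) = :Π_{i∈U} ψ_i:_S (ω′)` with `C i i′ = (L^kε)^{d−2}·propKer`
(r14's covariance kernels (2.30)/(2.32), mixed pairs `0`) — Janson Thm 4.9 + (4.3) for this law, via r14's `integral_law356_eq_gexp` and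
the functional engine `functional_wickProd_add_fluct` on p13's `gexp`; `μ₀², m² > 0`, `a > 0`, `L > 1`, `k ≤ K`.
[cite: Balaban1982Higgs1, (3.56)–(3.57) p.622] [cite: Janson1997, Thm 4.9 p.44, Thm 4.5 (4.3) p.43] [cite: GlimmJaffeQP1987, (9.1.20)–(9.1.21) §9.1 p.153] -/
theorem integral_wickProd_add_fluct_law356 (hμ : 0 < μ0sq) (hmsq : 0 < msq) (ha : 0 < a) (hL : 1 < (P.L : ℝ)) (hk : k ≤ P.K)
    {ι : Type} [LinearOrder ι] (lab : ι → Leg N P.d × HiggsLattice.Site P k) (S : ι → ι → ℝ) (ψ : ι → Ω' → ℝ) (ω' : Ω')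
    (U : Finset ι) :
    ∫ ω, wickProd (fun i i' => S i i' + P.mesh k ^ ((P.d : ℝ) - 2) * propKer C Ω B μ0sq msq a k (lab i).1 (lab i).2 (lab i').1 (lab i').2)
        (fun i ω => ψ i ω' + legVal k ω.1 (fieldOfCrd Finset.univ ω.2) (lab i).1 (lab i).2) U ω ∂(law356 C Ω B μ0sq msq a k) =
      wickProd S ψ U ω' := by
  classical
  rw [integral_law356_eq_gexp C Ω B hμ hmsq ha hL hk]
  have hX : (fun Φ => wickProd
        (fun i i' => S i i' + P.mesh k ^ ((P.d : ℝ) - 2) * propKer C Ω B μ0sq msq a k (lab i).1 (lab i).2 (lab i').1 (lab i').2)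
        (fun i ω => ψ i ω' + legVal k ω.1 (fieldOfCrd Finset.univ ω.2) (lab i).1 (lab i).2) U (Ψ k Φ)) =
      fun Φ => wickProd
        (fun i i' => S i i' + P.mesh k ^ ((P.d : ℝ) - 2) * propKer C Ω B μ0sq msq a k (lab i).1 (lab i).2 (lab i').1 (lab i').2)
        (fun i Φ => ψ i ω' + (fun i Φ => Φ ⬝ᵥ legVecS k (lab i).1 (lab i).2) i Φ) U Φ := by
    funext Φ
    exact wickProd_congr_apply _ fun i _ => congrArg (ψ i ω' + ·) (dotProduct_legVecS _ (lab i).1 (lab i).2 Φ).symm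
  rw [hX, functional_wickProd_add_fluct (gexp (blockPrec C Ω B μ0sq msq a k) 0)
    (gexp_sum_powerset_mul_prod (blockPrec_posDef C Ω B hμ hmsq ha hL hk) (fun i => legVecS k (lab i).1 (lab i).2) U)
    (fun R _ => gexp_prod_legVecS_eq_wickSum C Ω B hμ hmsq ha hL hk lab R) S ψ ω', one_mul]

/-- `S = 0` under the law of (3.56): `∫ :Π_{i∈U}(ψ_i + legVal_i):_C d(law356) = Π_{i∈U} ψ_i` (Glimm–Jaffe (9.1.21) after the translation by
the background). [cite: Balaban1982Higgs1, (3.56)–(3.57) p.622] [cite: GlimmJaffeQP1987, (9.1.21) §9.1 p.153, (9.1.27′) p.155] -/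
theorem integral_wickProd_add_fluct_law356_self (hμ : 0 < μ0sq) (hmsq : 0 < msq) (ha : 0 < a) (hL : 1 < (P.L : ℝ)) (hk : k ≤ P.K)
    {ι : Type} [LinearOrder ι] (lab : ι → Leg N P.d × HiggsLattice.Site P k) (ψ : ι → Ω' → ℝ) (ω' : Ω') (U : Finset ι) :
    ∫ ω, wickProd (fun i i' => P.mesh k ^ ((P.d : ℝ) - 2) * propKer C Ω B μ0sq msq a k (lab i).1 (lab i).2 (lab i').1 (lab i').2)
        (fun i ω => ψ i ω' + legVal k ω.1 (fieldOfCrd Finset.univ ω.2) (lab i).1 (lab i).2) U ω ∂(law356 C Ω B μ0sq msq a k) =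
      ∏ i ∈ U, ψ i ω' := by
  have hK : (fun i i' => P.mesh k ^ ((P.d : ℝ) - 2) * propKer C Ω B μ0sq msq a k (lab i).1 (lab i).2 (lab i').1 (lab i').2) =
      fun i i' => (fun _ _ : ι => (0 : ℝ)) i i' +
        P.mesh k ^ ((P.d : ℝ) - 2) * propKer C Ω B μ0sq msq a k (lab i).1 (lab i).2 (lab i').1 (lab i').2 := by
    funext i i'
    simp
  rw [hK, integral_wickProd_add_fluct_law356 C Ω B hμ hmsq ha hL hk lab (fun _ _ => (0 : ℝ)) ψ ω' U, wickProd_zeroKernel]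

/-- **Moments of the (3.57)-legs shifted by a background under the law of (3.56)**: `∫ Π_{i∈U}(ψ_i + legVal_i) d(law356) =
:Π_{i∈U} ψ_i:_{−C} (ω′)`, `C = (L^kε)^{d−2}·propKer`. [cite: Balaban1982Higgs1, (3.56)–(3.57) p.622] [cite: GlimmJaffeQP1987, (9.1.17) §9.1 p.153] -/
theorem integral_prod_legVal_add_law356 (hμ : 0 < μ0sq) (hmsq : 0 < msq) (ha : 0 < a) (hL : 1 < (P.L : ℝ)) (hk : k ≤ P.K)
    {ι : Type} [LinearOrder ι] (lab : ι → Leg N P.d × HiggsLattice.Site P k) (ψ : ι → Ω' → ℝ) (ω' : Ω') (U : Finset ι) :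
    ∫ ω, ∏ i ∈ U, (ψ i ω' + legVal k ω.1 (fieldOfCrd Finset.univ ω.2) (lab i).1 (lab i).2) ∂(law356 C Ω B μ0sq msq a k) =
      wickProd (fun i i' => -(P.mesh k ^ ((P.d : ℝ) - 2) * propKer C Ω B μ0sq msq a k (lab i).1 (lab i).2 (lab i').1 (lab i').2))
        ψ U ω' := by
  have hK : (fun _ _ : ι => (0 : ℝ)) = fun i i' =>
      -(P.mesh k ^ ((P.d : ℝ) - 2) * propKer C Ω B μ0sq msq a k (lab i).1 (lab i).2 (lab i').1 (lab i').2) +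
        P.mesh k ^ ((P.d : ℝ) - 2) * propKer C Ω B μ0sq msq a k (lab i).1 (lab i).2 (lab i').1 (lab i').2 := by
    funext i i'
    ring
  have h := integral_wickProd_add_fluct_law356 C Ω B hμ hmsq ha hL hk lab
    (fun i i' => -(P.mesh k ^ ((P.d : ℝ) - 2) * propKer C Ω B μ0sq msq a k (lab i).1 (lab i).2 (lab i').1 (lab i').2)) ψ ω' U
  rw [← hK] at h
  simp_rw [wickProd_zeroKernel] at h
  exact h

end Law356

/-! ## §3 p39's lattice Gaussian field `dμ_C` on `ηℤ^d`: field insertions `⟪φ(y_i), u_i⟫` -/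

section KernelField

open B3Sect3VectorSelfEnergy (ZSite)
open B3WTFreeMeasure (Cfg)
open B3WTFreeWick (scalarKernel kernelMeasure fld integral_inner_fld_inner_fldK)
open B3GaussianContractions (isGaussianProcess_inner_fld integral_inner_fld)

variable {d N : ℕ} {Cv : ZSite d → ℝ} {κ : Type*} [LinearOrder κ] {Ω' : Type*}

/-- **FLUCTUATION INTEGRATION AGAINST THE LATTICE GAUSSIAN FIELD `dμ_C`** (any positive-semidefinite colour-diagonal kernel
`δ_{ab}C(x−y)`, free boundary conditions `C = C^η_{M²}` included): for insertions `⟪φ(y_i),u_i⟫`, every Wick-ordering kernel `S` of the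
background and every background family `ψ_i(ω′)`, `∫ :Π_{i∈U}(ψ_i(ω′) + ⟪φ(y_i),u_i⟫):_{S+C} dμ_C(φ) = :Π_{i∈U} ψ_i:_S (ω′)` with
`C i j = C(y_i − y_j)⟪u_i,u_j⟫` ((2.26)) — Janson Thm 4.9 + (4.3) for this law, p39's Gaussian-process presentation
`isGaussianProcess_inner_fld` fed to `integral_wickProd_add_fluct`. [cite: Balaban1983Higgs3, (2.25)–(2.26) p.431]
[cite: Janson1997, Thm 4.9 p.44, Thm 4.5 (4.3) p.43] [cite: GlimmJaffeQP1987, (9.1.20)–(9.1.21) §9.1 p.153] -/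
theorem integral_wickProd_add_fluct_kernelMeasure (hK : IsPosSemidefKernel (scalarKernel d N Cv)) (y : κ → ZSite d)
    (u : κ → EuclideanSpace ℝ (Fin N)) (S : κ → κ → ℝ) (ψ : κ → Ω' → ℝ) (ω' : Ω') (U : Finset κ) :
    ∫ ω, wickProd (fun i j => S i j + Cv (y i - y j) * ⟪u i, u j⟫_ℝ) (fun i ω => ψ i ω' + ⟪fld ω (y i), u i⟫_ℝ) U ω
        ∂kernelMeasure d N Cv = wickProd S ψ U ω' := by
  have h := integral_wickProd_add_fluct (isGaussianProcess_inner_fld hK) (fun p => integral_inner_fld hK p.1 p.2)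
    (fun i => (y i, u i)) S ψ ω' U
  simp only [integral_inner_fld_inner_fldK hK] at h
  exact h

/-- `S = 0` under `dμ_C`: `∫ :Π_{i∈U}(ψ_i + ⟪φ(y_i),u_i⟫):_C dμ_C = Π_{i∈U} ψ_i`. [cite: Balaban1983Higgs3, (2.25)–(2.26) p.431]
[cite: GlimmJaffeQP1987, (9.1.21) §9.1 p.153, (9.1.27′) p.155] -/
theorem integral_wickProd_add_fluct_kernelMeasure_self (hK : IsPosSemidefKernel (scalarKernel d N Cv)) (y : κ → ZSite d)
    (u : κ → EuclideanSpace ℝ (Fin N)) (ψ : κ → Ω' → ℝ) (ω' : Ω') (U : Finset κ) :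
    ∫ ω, wickProd (fun i j => Cv (y i - y j) * ⟪u i, u j⟫_ℝ) (fun i ω => ψ i ω' + ⟪fld ω (y i), u i⟫_ℝ) U ω ∂kernelMeasure d N Cv =
      ∏ i ∈ U, ψ i ω' := by
  have h := integral_wickProd_add_fluct_self (isGaussianProcess_inner_fld hK) (fun p => integral_inner_fld hK p.1 p.2)
    (fun i => (y i, u i)) ψ ω' U
  simp only [integral_inner_fld_inner_fldK hK] at h
  exact h

/-- **Moments of the insertions shifted by a background under `dμ_C`**: `∫ Π_{i∈U}(ψ_i + ⟪φ(y_i),u_i⟫) dμ_C = :Π_{i∈U} ψ_i:_{−C} (ω′)`,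
`C i j = C(y_i − y_j)⟪u_i,u_j⟫`. [cite: Balaban1983Higgs3, (2.25)–(2.26) p.431] [cite: GlimmJaffeQP1987, (9.1.17) §9.1 p.153] -/
theorem integral_prod_inner_fld_add_kernelMeasure (hK : IsPosSemidefKernel (scalarKernel d N Cv)) (y : κ → ZSite d)
    (u : κ → EuclideanSpace ℝ (Fin N)) (ψ : κ → Ω' → ℝ) (ω' : Ω') (U : Finset κ) :
    ∫ ω, ∏ i ∈ U, (ψ i ω' + ⟪fld ω (y i), u i⟫_ℝ) ∂kernelMeasure d N Cv =
      wickProd (fun i j => -(Cv (y i - y j) * ⟪u i, u j⟫_ℝ)) ψ U ω' := by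
  have h := integral_prod_add_fluct_eq_wickProd_neg (isGaussianProcess_inner_fld hK) (fun p => integral_inner_fld hK p.1 p.2)
    (fun i => (y i, u i)) ψ ω' U
  simp only [integral_inner_fld_inner_fldK hK] at h
  exact h

end KernelField

/-! ## §4 `dμ_{C^{(j),L^jη}}` AS THE FLUCTUATION FACTOR OF A PRODUCT SPACE: the conditional expectation given the
background (Janson Thm 4.9 / Rem. 9.11 verbatim for the law of [III] (1.4)) -/

section FluctMeasureCondExp

open HiggsLattice (siteInner)
open B3MultiscaleFields (toSite)
open HiggsFluctMeasure (fluctMeasure fluctCov)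
open HiggsFluctMeasurePos (fluctMeasure_isProbability)
open HiggsFluctMeasureWick (integrable_prodLegs continuous_prodLegs)
open HiggsFluctMeasureWickSum (integral_prodLegs_eq_wickSum)

variable {P : HiggsLattice.Params} {msq a : ℝ} {j : ℕ} {ι : Type*} [LinearOrder ι]
variable {Ω' : Type*} {mΩ' : MeasurableSpace Ω'} {P' : Measure Ω'}

/-- A single leg `A′ ↦ ⟨A′, f⟩` is measurable (continuous). [cite: Balaban1983Higgs3, (1.4) p.414] -/
theorem measurable_leg (f : HiggsLattice.VecField P j) :
    Measurable fun B : HiggsLattice.VecField P j => siteInner (toSite B) (toSite f) := by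
  have h := (continuous_prodLegs (ι := Unit) {()} (fun _ => f)).measurable
  simpa using h

/-- **PRODUCT-SPACE FORM FOR `dμ_{C^{(j)}}`** (Janson Rem. 9.11): background `ψ` on `(Ω′,P′)`, fluctuation `A′ ∼ dμ_{C^{(j)}}`; for every
test function `F(ω′)` with `F·:Π_A ψ:_S` `P′`-integrable (`A ⊆ U`),
`∫ F(ω′)·:Π_{i∈U}(ψ_i(ω′) + ⟨A′,f_i⟩):_{S+C} d(P′ ⊗ dμ_{C^{(j)}}) = ∫ F(ω′)·:Π_{i∈U} ψ_i(ω′):_S dP′` (`C i i′ = ⟨f_{i′},C^{(j)}f_i⟩`;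
`msq > 0`, `a > 0`, `L > 1`, `j ≤ K`). [cite: Balaban1983Higgs3, (1.4) p.412, p.414] [cite: Janson1997, Thm 4.9 p.44, Rem. 9.11 p.125] -/
theorem integral_prod_mul_wickProd_add_fluct_fluctMeasure [SFinite P'] (hmsq : 0 < msq) (ha : 0 < a) (hL : 1 < (P.L : ℝ))
    (hj : j ≤ P.K) (f : ι → HiggsLattice.VecField P j) (S : ι → ι → ℝ) (ψ : ι → Ω' → ℝ) (F : Ω' → ℝ) (U : Finset ι)
    (hF : ∀ A, A ⊆ U → Integrable (fun ω' => F ω' * wickProd S ψ A ω') P') :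
    ∫ z, F z.1 * wickProd (fun i i' => S i i' + siteInner (toSite (f i')) (fluctCov P msq a j (toSite (f i))))
        (fun i (z : Ω' × HiggsLattice.VecField P j) => ψ i z.1 + siteInner (toSite z.2) (toSite (f i))) U z
        ∂(P'.prod (fluctMeasure P msq a j)) = ∫ ω', F ω' * wickProd S ψ U ω' ∂P' := by
  haveI := fluctMeasure_isProbability hmsq ha hL hj
  have h := integral_prod_mul_wickProd_add_fluct_of_wick (μ := fluctMeasure P msq a j) (P' := P') (U := U) (m := 1)
    (X := fun i A => siteInner (toSite A) (toSite (f i)))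
    (C := fun i i' => siteInner (toSite (f i')) (fluctCov P msq a j (toSite (f i))))
    (fun R _ => by rw [one_mul]; exact integral_prodLegs_eq_wickSum hmsq ha hL hj f R)
    (fun R _ => integrable_prodLegs hmsq ha hL hj R f) S ψ F hF
  rw [one_mul] at h
  exact h

/-- **JANSON'S THEOREM 4.9 FOR `dμ_{C^{(j)}}` AS MATHLIB'S `condExp`**: on `(Ω′ × 𝔄, P′ ⊗ dμ_{C^{(j)}})` (background coordinate `ω′`
with measurable `ψ_i` whose Wick products are `P′`-integrable, fluctuation coordinate `A′`),
`E[ :Π_{i∈U}(ψ_i + ⟨A′,f_i⟩):_{S+C} | σ(z ↦ z.1) ] = :Π_{i∈U} ψ_i:_S ∘ (z ↦ z.1)`  a.e. — *"integrating out the fluctuation field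
`A′_j` conditional on the background lowers the Wick order by `C^{(j)}`"*. [cite: Balaban1983Higgs3, (1.4) p.412, p.414]
[cite: Janson1997, Thm 4.9 p.44, Thm 4.5 (4.3) p.43, Rem. 9.11 p.125] [cite: GlimmJaffeQP1987, (9.1.20)–(9.1.21) §9.1 p.153] -/
theorem condExp_wickProd_add_fluct_fluctMeasure [IsFiniteMeasure P'] (hmsq : 0 < msq) (ha : 0 < a) (hL : 1 < (P.L : ℝ))
    (hj : j ≤ P.K) (f : ι → HiggsLattice.VecField P j) (S : ι → ι → ℝ) {ψ : ι → Ω' → ℝ} (hψm : ∀ i, Measurable (ψ i))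
    (U : Finset ι) (hψ : ∀ A, A ⊆ U → Integrable (fun ω' => wickProd S ψ A ω') P') :
    (P'.prod (fluctMeasure P msq a j))[fun z => wickProd (fun i i' => S i i' + siteInner (toSite (f i')) (fluctCov P msq a j (toSite (f i))))
        (fun i (z : Ω' × HiggsLattice.VecField P j) => ψ i z.1 + siteInner (toSite z.2) (toSite (f i))) U z |
        MeasurableSpace.comap Prod.fst inferInstance]
      =ᵐ[P'.prod (fluctMeasure P msq a j)] fun z => wickProd S ψ U z.1 := by
  haveI := fluctMeasure_isProbability hmsq ha hL hj
  exact condExp_wickProd_add_fluct_of_wick (μ := fluctMeasure P msq a j) (P' := P') (U := U)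
    (X := fun i A => siteInner (toSite A) (toSite (f i)))
    (C := fun i i' => siteInner (toSite (f i')) (fluctCov P msq a j (toSite (f i))))
    (fun R _ => integral_prodLegs_eq_wickSum hmsq ha hL hj f R |>.trans (one_mul _).symm)
    (fun R _ => integrable_prodLegs hmsq ha hL hj R f) (fun i => measurable_leg (f i)) S hψm hψ

end FluctMeasureCondExp

/-! ## §5 p39's `dμ_C` AS THE FLUCTUATION FACTOR OF A PRODUCT SPACE (Janson Thm 4.9 / Rem. 9.11 for the lattice
Gaussian field) -/

section KernelFieldCondExp

open B3Sect3VectorSelfEnergy (ZSite)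
open B3WTFreeMeasure (Cfg)
open B3WTFreeWick (scalarKernel kernelMeasure fld integral_inner_fld_inner_fldK measurable_inner_fld)
open B3GaussianContractions (isGaussianProcess_inner_fld integral_inner_fld)

variable {d N : ℕ} {Cv : ZSite d → ℝ} {κ : Type*} [LinearOrder κ]
variable {Ω' : Type*} {mΩ' : MeasurableSpace Ω'} {P' : Measure Ω'}

/-- **PRODUCT-SPACE FORM FOR `dμ_C`** (Janson Rem. 9.11): background `ψ` on `(Ω′,P′)`, lattice field `φ ∼ dμ_C`; for every test
function `F(ω′)` with `F·:Π_A ψ:_S` `P′`-integrable (`A ⊆ U`),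
`∫ F(ω′)·:Π_{i∈U}(ψ_i(ω′) + ⟪φ(y_i),u_i⟫):_{S+C} d(P′ ⊗ dμ_C) = ∫ F(ω′)·:Π_{i∈U} ψ_i(ω′):_S dP′`, `C i j = C(y_i−y_j)⟪u_i,u_j⟫`.
[cite: Balaban1983Higgs3, (2.25)–(2.26) p.431] [cite: Janson1997, Thm 4.9 p.44, Rem. 9.11 p.125] -/
theorem integral_prod_mul_wickProd_add_fluct_kernelMeasure [SFinite P'] (hK : IsPosSemidefKernel (scalarKernel d N Cv))
    (y : κ → ZSite d) (u : κ → EuclideanSpace ℝ (Fin N)) (S : κ → κ → ℝ) (ψ : κ → Ω' → ℝ) (F : Ω' → ℝ) (U : Finset κ)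
    (hF : ∀ A, A ⊆ U → Integrable (fun ω' => F ω' * wickProd S ψ A ω') P') :
    ∫ z, F z.1 * wickProd (fun i j => S i j + Cv (y i - y j) * ⟪u i, u j⟫_ℝ)
        (fun i (z : Ω' × Cfg d N) => ψ i z.1 + ⟪fld z.2 (y i), u i⟫_ℝ) U z ∂(P'.prod (kernelMeasure d N Cv)) =
      ∫ ω', F ω' * wickProd S ψ U ω' ∂P' := by
  have h := integral_prod_mul_wickProd_add_fluct (P' := P') (isGaussianProcess_inner_fld hK)
    (fun p => integral_inner_fld hK p.1 p.2) (fun i => (y i, u i)) S ψ F U hF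
  simp only [integral_inner_fld_inner_fldK hK] at h
  exact h

/-- **JANSON'S THEOREM 4.9 FOR `dμ_C` AS MATHLIB'S `condExp`**: on `(Ω′ × Cfg, P′ ⊗ dμ_C)` (measurable background `ψ_i` with
`P′`-integrable Wick products), `E[ :Π_{i∈U}(ψ_i + ⟪φ(y_i),u_i⟫):_{S+C} | σ(z ↦ z.1) ] = :Π_{i∈U} ψ_i:_S ∘ (z ↦ z.1)`  a.e.
[cite: Balaban1983Higgs3, (2.25)–(2.26) p.431] [cite: Janson1997, Thm 4.9 p.44, Thm 4.5 (4.3) p.43, Rem. 9.11 p.125] -/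
theorem condExp_wickProd_add_fluct_kernelMeasure [IsFiniteMeasure P'] (hK : IsPosSemidefKernel (scalarKernel d N Cv))
    (y : κ → ZSite d) (u : κ → EuclideanSpace ℝ (Fin N)) (S : κ → κ → ℝ) {ψ : κ → Ω' → ℝ} (hψm : ∀ i, Measurable (ψ i))
    (U : Finset κ) (hψ : ∀ A, A ⊆ U → Integrable (fun ω' => wickProd S ψ A ω') P') :
    (P'.prod (kernelMeasure d N Cv))[fun z => wickProd (fun i j => S i j + Cv (y i - y j) * ⟪u i, u j⟫_ℝ)
        (fun i (z : Ω' × Cfg d N) => ψ i z.1 + ⟪fld z.2 (y i), u i⟫_ℝ) U z | MeasurableSpace.comap Prod.fst inferInstance]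
      =ᵐ[P'.prod (kernelMeasure d N Cv)] fun z => wickProd S ψ U z.1 := by
  have h := condExp_wickProd_add_fluct (P' := P') (isGaussianProcess_inner_fld hK) (fun p => integral_inner_fld hK p.1 p.2)
    (fun i => (y i, u i)) (fun i => measurable_inner_fld (y i) (u i)) S hψm U hψ
  simp only [integral_inner_fld_inner_fldK hK] at h
  exact h

end KernelFieldCondExp

end Literature.MathematicalPhysics.QuantumFieldTheory.Balaban1983to89.HiggsFluctMeasureWickProdFluctuationModels

end
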